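import Mathlib
import Summits.Langlands.Langlands.Statement
import Literature.NumberTheory.Automorphic.StrongArtinGL2
import Literature.NumberTheory.Automorphic.TunnellOctahedralGlobal
import Literature.NumberTheory.Automorphic.CuspidalContragredientProofs
import Literature.NumberTheory.GaloisRepresentations.GaloisRepFrobeniusProofs
import Literature.NumberTheory.GaloisRepresentations.IntegralGaloisActionProofs

/-!
# Icosahedral quadratic descent — preliminaries, II: Frobenius roots; from the route's
# `2`-adic compatibility to `IsPiOfArtinRep` of the contragredient

* `frobRoots ρ v`: the multiset of roots of the chosen Frobenius characteristic polynomial of a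
  rank-`2` Artin representation at `v`, with its API at unramified places.
* `exists_isPiOfArtinRep_of_satakeFrobCompatibleAt`: if `σ : Γ_E → GL₂(ℚ̄₂)` is entrywise the
  `ι`-transport of `ρ|_{Γ_E}` and `π` is Satake–Frobenius compatible with `σ` a.e. in the summit's
  (inverse-root) normalisation, then the contragredient datum `π^∨` (a theorem of the tree,
  `exists_contragredient_satake_holds`) is `π(ρ|_{Γ_E})` in Tunnell's sense (`IsPiOfArtinRep`).
-/

set_option linter.dupNamespace false

noncomputable section

open scoped MatrixGroups NumberField Polynomial
open NumberField IsDedekindDomain Field Polynomial Filter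
open Literature.NumberTheory.Automorphic Literature.NumberTheory.GaloisRepresentations

namespace Summit.Langlands.Langlands.Theorems.IcosahedralQuadraticDescent

/-! ## Frobenius roots of a rank-two Artin representation -/

section FrobRoots

variable {F : Type} [Field F] [NumberField F]

/-- The multiset of roots of the Frobenius characteristic polynomial of `ρ` at `v` (the
Frobenius eigenvalues when `ρ` is unramified at `v`; junk otherwise). [folklore] -/
def frobRoots (ρ : FramedArtinRep F 2) (v : HeightOneSpectrum (𝓞 F)) : Multiset ℂ :=
  (ρ.toGaloisRep.frobCharpoly v).roots

/-- At an unramified place, `frobRoots ρ v` has two elements and its Satake polynomial is the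
Frobenius characteristic polynomial of `ρ` at `v`. [folklore] -/
theorem card_frobRoots_and_hasFrobCharpolyAt (ρ : FramedArtinRep F 2) {v : HeightOneSpectrum (𝓞 F)}
    (hv : ρ.IsUnramifiedAt v) :
    Multiset.card (frobRoots ρ v) = 2 ∧ ρ.HasFrobCharpolyAt v (satakePolynomial (frobRoots ρ v)) := by
  obtain ⟨𝔓, h𝔓⟩ := HeightOneSpectrum.primesAbove_nonempty v
  obtain ⟨φ, hφ⟩ := HeightOneSpectrum.exists_isArithFrobAt_of_mem_primesAbove_holds h𝔓
  have hunr : ρ.toGaloisRep.IsUnramifiedAt v := (FramedGaloisRep.isUnramifiedAt_toGaloisRep_iff v ρ).mpr hv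
  have hP : ρ.HasFrobCharpolyAt v (ρ.toGaloisRep.frobCharpoly v) :=
    (FramedGaloisRep.hasFrobCharpolyAt_toGaloisRep_iff v _ ρ).mp
      (GaloisRep.hasFrobCharpolyAt_frobCharpoly_holds hunr)
  set P := ρ.toGaloisRep.frobCharpoly v with hPdef
  have hch : FramedRep.charpoly ρ φ = P := hP 𝔓 h𝔓 φ hφ
  have hmonic : P.Monic := by rw [← hch]; exact Matrix.charpoly_monic _
  have hdeg : P.natDegree = 2 := by
    rw [← hch, FramedRep.charpoly, Matrix.charpoly_natDegree_eq_dim, Fintype.card_fin]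
  have hcard : Multiset.card P.roots = P.natDegree :=
    (Polynomial.Splits.natDegree_eq_card_roots (IsAlgClosed.splits P)).symm
  have hprod : satakePolynomial P.roots = P := by
    rw [satakePolynomial]
    exact Polynomial.prod_multiset_X_sub_C_of_monic_of_roots_card_eq hmonic hcard
  refine ⟨by rw [frobRoots, hcard, hdeg], ?_⟩
  rw [frobRoots, hprod]
  exact hP

/-- At an unramified place, every arithmetic Frobenius `φ` above `v` has characteristic
polynomial `satakePolynomial (frobRoots ρ v)`. [folklore] -/
theorem charpoly_eq_satakePolynomial_frobRoots (ρ : FramedArtinRep F 2)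
    {v : HeightOneSpectrum (𝓞 F)} (hv : ρ.IsUnramifiedAt v)
    {𝔓 : Ideal (absIntegers (𝓞 F) F)} (h𝔓 : 𝔓 ∈ v.primesAbove) {φ : absoluteGaloisGroup F}
    (hφ : IsArithFrobAt (𝓞 F) φ 𝔓) :
    ((ρ φ : GL (Fin 2) ℂ) : Matrix (Fin 2) (Fin 2) ℂ).charpoly = satakePolynomial (frobRoots ρ v) :=
  (card_frobRoots_and_hasFrobCharpolyAt ρ hv).2 𝔓 h𝔓 φ hφ

/-- If some arithmetic Frobenius above the unramified place `v` acts through `ρ` as the scalar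
`u`, then `frobRoots ρ v = {u, u}`. [folklore] -/
theorem frobRoots_eq_pair_of_apply_eq_scalar (ρ : FramedArtinRep F 2)
    {v : HeightOneSpectrum (𝓞 F)} (hv : ρ.IsUnramifiedAt v)
    {𝔓 : Ideal (absIntegers (𝓞 F) F)} (h𝔓 : 𝔓 ∈ v.primesAbove) {φ : absoluteGaloisGroup F}
    (hφ : IsArithFrobAt (𝓞 F) φ 𝔓) {u : ℂˣ}
    (hu : ρ φ = Matrix.GeneralLinearGroup.scalar (Fin 2) u) :
    frobRoots ρ v = {(u : ℂ), (u : ℂ)} := by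
  have h := charpoly_eq_satakePolynomial_frobRoots ρ hv h𝔓 hφ
  rw [hu, Matrix.GeneralLinearGroup.coe_scalar, Matrix.scalar_apply, Matrix.charpoly_diagonal] at h
  have h2 : satakePolynomial {(u : ℂ), (u : ℂ)} = satakePolynomial (frobRoots ρ v) := by
    rw [← h, satakePolynomial_pair, Fin.prod_univ_two]
  have h3 := congrArg Polynomial.roots h2
  rwa [roots_satakePolynomial, roots_satakePolynomial, eq_comm] at h3

/-- An Artin representation is unramified at all but finitely many places. [folklore] -/
theorem eventually_isUnramifiedAt (ρ : FramedArtinRep F 2) :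
    ∀ᶠ v : HeightOneSpectrum (𝓞 F) in cofinite, ρ.IsUnramifiedAt v :=
  haveI : Finite ρ.toMonoidHom.range := finite_range_toMonoidHom ρ
  FramedGaloisRep.eventually_isUnramifiedAt_of_isOpen_ker ρ (isOpen_ker_of_finite_range ρ)

end FrobRoots

/-! ## From the summit's `2`-adic compatibility to `IsPiOfArtinRep` of the contragredient -/

section Conversion

variable {E : Type} [Field E] [NumberField E] {hcpt : isCompact_glFiniteIntegralLevel 2 E}

omit [NumberField E] in
/-- Matrix form of the entrywise relation `ι(σ(g)_{ij}) = ρ'(g)_{ij}`. [folklore] -/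
theorem coe_eq_map_of_entrywise (ι : PadicAlgCl 2 ≃+* ℂ)
    (σ : FramedGaloisRep E (PadicAlgCl 2) 2) (ρ' : FramedArtinRep E 2)
    (hσ : ∀ (g : absoluteGaloisGroup E) (i j : Fin 2), ι ((σ g).val i j) = (ρ' g).val i j)
    (g : absoluteGaloisGroup E) :
    ((ρ' g : GL (Fin 2) ℂ) : Matrix (Fin 2) (Fin 2) ℂ) =
      ((σ g : GL (Fin 2) (PadicAlgCl 2)) : Matrix (Fin 2) (Fin 2) (PadicAlgCl 2)).map
        (ι : PadicAlgCl 2 →+* ℂ) := by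
  ext i j
  exact (hσ g i j).symm

omit [NumberField E] in
/-- Unramifiedness transfers along the entrywise relation. [folklore] -/
theorem isUnramifiedAt_of_entrywise (ι : PadicAlgCl 2 ≃+* ℂ)
    (σ : FramedGaloisRep E (PadicAlgCl 2) 2) (ρ' : FramedArtinRep E 2)
    (hσ : ∀ (g : absoluteGaloisGroup E) (i j : Fin 2), ι ((σ g).val i j) = (ρ' g).val i j)
    {w : HeightOneSpectrum (𝓞 E)} (hw : σ.IsUnramifiedAt w) : ρ'.IsUnramifiedAt w := by
  intro 𝔓 h𝔓 g hg
  have h1 := hw 𝔓 h𝔓 g hg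
  refine Units.ext ?_
  rw [coe_eq_map_of_entrywise ι σ ρ' hσ g, h1]
  simp [Matrix.map_one]

/-- The Frobenius characteristic polynomial transfers along the entrywise relation: the
`ι`-image of `∏ (X - ι⁻¹(a⁻¹))` is `∏ (X - a⁻¹)`, the Satake polynomial of `α⁻¹`. [folklore] -/
theorem hasFrobCharpolyAt_of_entrywise (ι : PadicAlgCl 2 ≃+* ℂ)
    (σ : FramedGaloisRep E (PadicAlgCl 2) 2) (ρ' : FramedArtinRep E 2)
    (hσ : ∀ (g : absoluteGaloisGroup E) (i j : Fin 2), ι ((σ g).val i j) = (ρ' g).val i j)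
    {w : HeightOneSpectrum (𝓞 E)} {α : Multiset ℂ}
    (hP : σ.HasFrobCharpolyAt w (arithFrobPolyOfSatake ι w.residueCard 1 α)) :
    ρ'.HasFrobCharpolyAt w (satakePolynomial (α.map (·⁻¹))) := by
  intro 𝔓 h𝔓 g hg
  have h1 : FramedRep.charpoly σ g = arithFrobPolyOfSatake ι w.residueCard 1 α := hP 𝔓 h𝔓 g hg
  unfold FramedRep.charpoly at h1 ⊢
  rw [coe_eq_map_of_entrywise ι σ ρ' hσ g, Matrix.charpoly_map, h1, arithFrobPolyOfSatake_one,
    Polynomial.map_multiset_prod, Multiset.map_map, satakePolynomial, Multiset.map_map]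
  congr 1
  refine Multiset.map_congr rfl fun a _ => ?_
  simp only [Function.comp_apply, Polynomial.map_sub, Polynomial.map_X, Polynomial.map_C,
    RingHom.coe_coe, RingEquiv.apply_symm_apply]

/-- **From the route's hypothesis to Tunnell's `IsPiOfArtinRep`.**  If `σ` is entrywise the
`ι`-transport of the Artin representation `ρ'` and the cuspidal `π` is Satake–Frobenius compatible
with `σ` at almost all places (summit normalisation: Satake parameters = inverse Frobenius roots),
then the contragredient cuspidal datum `π^∨` (`exists_contragredient_satake_holds`, Satake
parameters inverted at every place) equals `π(ρ')`: `IsPiOfArtinRep ρ' π^∨`. [folklore] -/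
theorem exists_isPiOfArtinRep_of_satakeFrobCompatibleAt (ι : PadicAlgCl 2 ≃+* ℂ)
    (σ : FramedGaloisRep E (PadicAlgCl 2) 2) (ρ' : FramedArtinRep E 2)
    (hσ : ∀ (g : absoluteGaloisGroup E) (i j : Fin 2), ι ((σ g).val i j) = (ρ' g).val i j)
    (π : CuspidalAutomorphicRepData 2 E hcpt)
    (hπ : ∀ᶠ w : HeightOneSpectrum (𝓞 E) in cofinite, Summit.Langlands.SatakeFrobCompatibleAt ι π.1 σ w) :
    ∃ P : CuspidalAutomorphicRepData 2 E hcpt, IsPiOfArtinRep ρ' P.1 := by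
  obtain ⟨P, hP⟩ := CuspidalAutomorphicRepData.exists_contragredient_satake_holds (hcpt := hcpt) π
  refine ⟨P, ?_⟩
  filter_upwards [hπ] with w hw
  obtain ⟨α, hα, hunr, hpoly⟩ := hw
  exact ⟨α.map (·⁻¹), hP w α hα, isUnramifiedAt_of_entrywise ι σ ρ' hσ hunr,
    hasFrobCharpolyAt_of_entrywise ι σ ρ' hσ hpoly⟩

end Conversion

end Summit.Langlands.Langlands.Theorems.IcosahedralQuadraticDescent

end
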